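import Literature.NumberTheory.LFunctions.DirichletZeroDensitySevenThirdsMult
import Literature.NumberTheory.LFunctions.BondarenkoHeap2026Sections3to5
import Literature.NumberTheory.LFunctions.ExplicitFormulaPsiCharHeights
import Literature.NumberTheory.LFunctions.ZeroDensityInghamHuxley
import Literature.NumberTheory.LFunctions.BondarenkoHeap2026Section2Proofs
import Literature.NumberTheory.LFunctions.BondarenkoHeap2026Sections3to5Proofs
import Literature.NumberTheory.LFunctions.BondarenkoHeap2026DiagonalProofs
import Literature.NumberTheory.LFunctions.BondarenkoHeap2026Section6Proofs
import Literature.NumberTheory.LFunctions.BondarenkoHeap2026Section6Reduction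
import Literature.NumberTheory.LFunctions.BondarenkoHeap2026Numerics
import Literature.NumberTheory.LFunctions.BondarenkoHeap2026CharacterSumsProofs
import Literature.NumberTheory.LFunctions.BondarenkoHeap2026CompleteSumsProofs
import Literature.NumberTheory.LFunctions.BondarenkoHeap2026PrimeSumsProofs
import Literature.NumberTheory.LFunctions.BondarenkoHeap2026OffDiagonalProofs
import Literature.NumberTheory.LFunctions.BondarenkoHeap2026Prop3Proofs
import Literature.NumberTheory.LFunctions.BondarenkoHeap2026Prop1Proofs
import Literature.NumberTheory.LFunctions.BondarenkoHeap2026Section6Weights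
import Literature.NumberTheory.LFunctions.BondarenkoHeap2026Section6WeightsProofs
import Literature.NumberTheory.LFunctions.BondarenkoHeap2026OffDiagReductionAssembly
import HarnessLib

/-!
# Bondarenko–Heap 2026, Proposition 2 FROM Chen–Gupta–Li's Theorem 1.2: the bridge
# `ChenGuptaLi2025.theorem12_allCases_mult → BondarenkoHeap2026.prop2`

LABEL (C5 / rh-crit-ah, LADDER-RH §4 HELD «conditional bridges: exceptional zero ⇒ …»):
**NOT RH-BEARING.** This module PROVES that Bondarenko–Heap's quoted zero-density input
(their Proposition 2, eq. (9), the tree's named fact `BondarenkoHeap2026.prop2`, the sole residual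
leaf of the kernel census of their Theorem 1) follows from the external theorem it cites,
Chen–Gupta–Li arXiv:2507.08296v2 Theorem 1.2 («In all cases» display, zeros counted with
multiplicity = the tree's named fact `ChenGuptaLi2025.theorem12_allCases_mult`, module
`DirichletZeroDensitySevenThirdsMult`). Everything here is an RH-FREE theorem ABOUT two typed
statements; no `RiemannHypothesis`, no gap statement, no new definition, no new named fact.
Nothing here bears on the truth of RH.

## The two statements (as typed)

* `BondarenkoHeap2026.prop2` (BH26 Prop 2, (9), §3 p. 9): for every `ε > 0` there is `C > 0` with
  `Σ*_{ψ mod q primitive} N(σ, H, ψ) ≤ C (qH)^{7(1−σ)/3+ε}` for ALL `q ≥ 1`, `1/2 ≤ σ < 1`, `H ≥ 1`,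
  where `N(σ, H, ψ) = charZeroCountRe ψ σ H` counts the zeros with `β > σ`, `|γ| ≤ H` WITH
  multiplicity; the constant is uniform in `σ`.
* `ChenGuptaLi2025.theorem12_allCases_mult` (CGL Thm 1.2): for every FIXED `σ ∈ (1/2, 1)` and
  `ε > 0` a constant `C(σ, ε)` with `Σ_{χ mod q} N(σ, T, χ) ≤ C (qT)^ε (q^{7(1−σ)/3}T^{2(1−σ)}
  + (qT)^{30(1−σ)/13})`, `q, T ≥ 1`, where `N(σ, T, χ) = charZeroCountMult χ σ T` counts `β ≥ σ`,
  `|γ| ≤ T` with multiplicity over ALL characters.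

## The proof (ours — Bondarenko–Heap write "This is due to Chen–Gupta–Li"; the deduction is routine
## but not a one-liner, because of three mismatches between the two typed shapes)

1. COUNTS (`charZeroCountRe_le_charZeroCountMult`, `sum_charZeroCountRe_le_modZeroCountMult`):
   `{β > σ} ⊆ {β ≥ σ}`, primitive characters are among all characters, and both counts are finite
   sums of the same multiplicities `DirichletDisc.zeroOrder` — for `q > 1` a primitive `ψ` is
   non-principal (entire `L`), and for `q = 1` the unique character has `L(s, ψ) = ζ(s)`
   (`DirichletCharacter.LFunction_modOne_eq`), whose zeros in a compact box are finitely many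
   (`IsCompact.inter_riemannZetaZeros_finite`).
2. EXPONENTS (`ChenGuptaLi2025.sevenThirds_mult_of_allCases_mult`, sibling module): for `q, T ≥ 1`
   the two-term bound is `≤ 2 (qT)^{7(1−σ)/3}`.
3. UNIFORMITY IN `σ` AND THE ENDPOINT `σ = 1/2` (`prop2_of_theorem12_allCases_mult`): `N(σ, H, ψ)`
   is non-increasing in `σ` (`charZeroCountRe_anti`); on a grid `σ_j = 1/2 + jδ`,
   `δ = min(1/14, 3ε/14)`, the pointwise bounds at `σ_j` with `ε/2` cover `σ ∈ [σ_j, σ_j + δ)` at the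
   cost `7δ/3 ≤ ε/2` in the exponent; the first strip `σ ∈ [1/2, 1/2 + δ) ⊆ [1/2, 4/7]` — which
   contains the endpoint `σ = 1/2` that CGL's open range `1/2 < σ` does not cover — is served by the
   TRIVIAL count `Σ*_ψ N(1/2, H, ψ) ≤ K(ε) (qH)^{1+ε}` (`exists_sum_charZeroCountRe_half_le_rpow`),
   valid there because `7(1−σ)/3 ≥ 1` for `σ ≤ 4/7`. The trivial count is PROVED from the tree:
   zeros of a primitive `L(s, ψ)`, `q > 1`, in a unit window are `≪ log q + log(|τ| + 4)`
   (`ExplicitPsiChar.exists_sum_window_le`, Montgomery–Vaughan Thm 10.17, Jensen) summed over the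
   `≤ 2H + 5` windows meeting `|γ| ≤ H`, and for `q = 1` the `ζ` count
   `Literature.NumberTheory.LFunctions.exists_sum_zeroOrder_le_mul_log` (MV Thm 10.13 summed);
   there are `φ(q) ≤ q` characters (`DirichletCharacter.card_eq_totient_of_hasEnoughRootsOfUnity`).
   NOTE (n-class, not an erratum): Bondarenko–Heap state (9) on `1/2 ≤ σ < 1`; at and near
   `σ = 1/2` the bound `(qH)^{7/6+ε}` is weaker than the Riemann–von Mangoldt count and holds for
   that reason, not by Chen–Gupta–Li's theorem (whose range is `1/2 < σ < 1`).

## The apex in the tree (v2; kernel census v22 lineage)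

With `prop2` derived from the external theorem, EVERY Bondarenko–Heap named fact downstream of it
is a tree theorem from `ChenGuptaLi2025.theorem12_allCases_mult` BY NAME, composed here once (the
lead's census scratch `ApexLeavesV22.lean`, 2026-08-26T18:47Z, put into the kernel tree):
`rangeIII'_bound` / `lemma10` / `lemma10'` / `prop6` / `theorem4` / `equation8`
(`…_of_theorem12_allCases_mult`, via the landed `rangeIII'_bound_of_prop2`, `lemma10_of_prop2`,
`lemma10'_of_prop2`, `prop6_of_reduction'_of_ranges' offDiag_reduction'_holds rangeI'_bound_holds
rangeII'_bound_holds`, `theorem4_of_prop3_prop6 prop3_holds`, `equation8_glue_holds proposition1_holds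
theorem3_holds … cPhi_pos_holds weightHat_zero_holds extensionToLine_holds`), and the apex
`bondarenkoHeap2026_theorem1_of_theorem12_allCases_mult :
ChenGuptaLi2025.theorem12_allCases_mult → bondarenkoHeap2026_theorem1`
(`∘ bondarenkoHeap2026_theorem1_of_internal … numericalInequality8_holds`) with its corollary
`bondarenkoHeap2026_corollary2_of_theorem12_allCases_mult` (`∘ bondarenkoHeap2026_corollary2_of_theorem1`).
Census lineage: v17 {offDiag_reduction, prop2} → v20 {offDiag_reduction′, prop2} → v21 {prop2} →
v22 {`ChenGuptaLi2025.theorem12_allCases_mult`}. The apex is itself the printed CONDITIONAL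
«Siegel zeros of quality `𝓔 ≥ E₀` ⇒ (RH ⇒ liminf of normalised gaps `< 0.4733…`)» of an unrefereed
preprint, now resting on one cited RH-free external theorem; nothing here asserts RH, the
existence of Siegel zeros, or small gaps. NOT RH-BEARING.

References: [cite: BondarenkoHeap2026, Proposition 2, eq. (9), §3 p. 9 (arXiv:2608.07399v1 TeX
l.433–445)]; [cite: ChenGuptaLi2025, Theorem 1.2 («In all cases»), arXiv v2 TeX l.178–182, p. 3];
[cite: MontgomeryVaughan2007, Theorems 10.13, 10.17].
-/

noncomputable section

open scoped Classical
open Complex Finset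

namespace Literature.NumberTheory.LFunctions.BondarenkoHeap2026

open ThornerZaman2024PNTAP (zeroSetGe)
open ChenGuptaLi2025 (charZeroCountMult modZeroCountMult theorem12_allCases_mult)
open Literature.NumberTheory.LFunctions.DirichletDisc (zeroOrder)

/-! ### Level one: the unique character modulo `1` and `ζ` -/

/-- For the (unique) character `ψ` modulo `1`, `L(s, ψ) = ζ(s)` and the printed zero set
`{β > σ, |γ| ≤ H}` of `L(s, ψ)` is finite: it lies in the compact box `[σ, 1] × [−H, H]`
(`ζ(s) ≠ 0` for `Re s ≥ 1`) and the zeros of `ζ` meet every compact set in a finite set.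
[cite: BondarenkoHeap2026, §3 (definition of N(σ,H,ψ)), p. 9] -/
theorem zeroSetRe_finite_level_one (ψ : DirichletCharacter ℂ 1) (σ H : ℝ) :
    (zeroSetRe ψ σ H).Finite := by
  have hK : IsCompact (Set.Icc σ 1 ×ℂ Set.Icc (-H) H) := isCompact_Icc.reProdIm isCompact_Icc
  refine hK.inter_riemannZetaZeros_finite.subset ?_
  rintro ρ ⟨h0, h1, h2⟩
  rw [DirichletCharacter.LFunction_modOne_eq] at h0
  have hre : ρ.re ≤ 1 := by
    by_contra hre
    exact riemannZeta_ne_zero_of_one_le_re (not_le.mp hre).le h0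
  exact ⟨Complex.mem_reProdIm.2 ⟨⟨h1.le, hre⟩, abs_le.1 h2⟩, h0⟩

/-- Same for Chen–Gupta–Li's closed zero set `{β ≥ σ, |γ| ≤ T}` of the character modulo `1`.
[cite: ChenGuptaLi2025, §1 (definition of N(σ,T,χ)), arXiv v2 TeX l.141] -/
theorem zeroSetGe_finite_level_one (ψ : DirichletCharacter ℂ 1) (σ T : ℝ) :
    (zeroSetGe ψ σ T).Finite := by
  have hK : IsCompact (Set.Icc σ 1 ×ℂ Set.Icc (-T) T) := isCompact_Icc.reProdIm isCompact_Icc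
  refine hK.inter_riemannZetaZeros_finite.subset ?_
  rintro ρ ⟨h0, h1, h2⟩
  rw [DirichletCharacter.LFunction_modOne_eq] at h0
  have hre : ρ.re ≤ 1 := by
    by_contra hre
    exact riemannZeta_ne_zero_of_one_le_re (not_le.mp hre).le h0
  exact ⟨Complex.mem_reProdIm.2 ⟨⟨h1, hre⟩, abs_le.1 h2⟩, h0⟩

/-- For the character modulo `1` the tree's multiplicity `DirichletDisc.zeroOrder ψ ρ`
(`analyticOrderNatAt` of `L(s, ψ) = ζ(s)`) agrees with the tree's `riemannZetaZeroOrder ρ`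
(the meromorphic order of `ζ`) at every `ρ ≠ 1`. [folklore] -/
private theorem natCast_zeroOrder_level_one (ψ : DirichletCharacter ℂ 1) {ρ : ℂ} (hρ : ρ ≠ 1) :
    ((zeroOrder ψ ρ : ℕ) : ℤ) = riemannZetaZeroOrder ρ := by
  have han : AnalyticAt ℂ riemannZeta ρ := analyticOn_riemannZeta ρ hρ
  rw [riemannZetaZeroOrder, han.meromorphicOrderAt_eq, DirichletDisc.zeroOrder,
    DirichletCharacter.LFunction_modOne_eq, analyticOrderNatAt]
  cases analyticOrderAt riemannZeta ρ with
  | top => simp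
  | coe n => simp

/-! ### Finiteness and comparison of the two counts, for primitive characters -/

/-- A primitive character modulo `q > 1` is not the principal character. [folklore] -/
private theorem ne_one_of_isPrimitive_of_ne_one {q : ℕ} [NeZero q] {ψ : DirichletCharacter ℂ q}
    (hψ : ψ.IsPrimitive) (hq : q ≠ 1) : ψ ≠ 1 :=
  ExplicitPsiChar.ne_one_of_isPrimitive hψ (Nat.one_lt_iff_ne_zero_and_ne_one.2 ⟨NeZero.ne q, hq⟩)

/-- Bondarenko–Heap's zero set `{β > σ, |γ| ≤ H}` of a PRIMITIVE character is finite for `σ ≥ 0`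
(`q > 1`: `zeroSetRe_finite`; `q = 1`: the `ζ` case). [cite: BondarenkoHeap2026, §3 (definition of N(σ,H,ψ)), p. 9] -/
theorem zeroSetRe_finite_of_isPrimitive {q : ℕ} [NeZero q] {ψ : DirichletCharacter ℂ q}
    (hψ : ψ.IsPrimitive) {σ : ℝ} (hσ : 0 ≤ σ) (H : ℝ) : (zeroSetRe ψ σ H).Finite := by
  rcases eq_or_ne q 1 with rfl | hq
  · exact zeroSetRe_finite_level_one ψ σ H
  · exact zeroSetRe_finite (ne_one_of_isPrimitive_of_ne_one hψ hq) hσ H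

/-- Chen–Gupta–Li's zero set `{β ≥ σ, |γ| ≤ T}` of a PRIMITIVE character is finite for `σ > 0`.
[cite: ChenGuptaLi2025, §1 (definition of N(σ,T,χ)), arXiv v2 TeX l.141] -/
theorem zeroSetGe_finite_of_isPrimitive {q : ℕ} [NeZero q] {ψ : DirichletCharacter ℂ q}
    (hψ : ψ.IsPrimitive) {σ : ℝ} (hσ : 0 < σ) (T : ℝ) : (zeroSetGe ψ σ T).Finite := by
  rcases eq_or_ne q 1 with rfl | hq
  · exact zeroSetGe_finite_level_one ψ σ T
  · exact ChenGuptaLi2025.zeroSetGe_finite (ne_one_of_isPrimitive_of_ne_one hψ hq) hσ T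

/-- **`N(σ, H, ψ)` is non-increasing in `σ`** (primitive `ψ`, `0 ≤ σ ≤ σ'`): the zero set shrinks
and the multiplicities are the same. [cite: BondarenkoHeap2026, §3 (definition of N(σ,H,ψ)), p. 9] -/
theorem charZeroCountRe_anti {q : ℕ} [NeZero q] {ψ : DirichletCharacter ℂ q} (hψ : ψ.IsPrimitive)
    {σ σ' : ℝ} (hσ : 0 ≤ σ) (hle : σ ≤ σ') (H : ℝ) :
    charZeroCountRe ψ σ' H ≤ charZeroCountRe ψ σ H := by
  have hfin := zeroSetRe_finite_of_isPrimitive hψ hσ H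
  have hsub : zeroSetRe ψ σ' H ⊆ zeroSetRe ψ σ H :=
    fun ρ ⟨h0, h1, h2⟩ ↦ ⟨h0, lt_of_le_of_lt hle h1, h2⟩
  unfold charZeroCountRe
  rw [finsum_mem_eq_finite_toFinset_sum _ (hfin.subset hsub), finsum_mem_eq_finite_toFinset_sum _ hfin]
  exact Finset.sum_le_sum_of_subset (Set.Finite.toFinset_subset_toFinset.2 hsub)

/-- **BH's count is at most CGL's count** for a primitive character and `σ > 0`:
`#{β > σ, |γ| ≤ T} ≤ #{β ≥ σ, |γ| ≤ T}` with multiplicities.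
[cite: BondarenkoHeap2026, Proposition 2 (attribution to Chen–Gupta–Li), p. 9] -/
theorem charZeroCountRe_le_charZeroCountMult {q : ℕ} [NeZero q] {ψ : DirichletCharacter ℂ q}
    (hψ : ψ.IsPrimitive) {σ : ℝ} (hσ : 0 < σ) (T : ℝ) :
    charZeroCountRe ψ σ T ≤ charZeroCountMult ψ σ T := by
  have hfin := zeroSetGe_finite_of_isPrimitive hψ hσ T
  have hsub : zeroSetRe ψ σ T ⊆ zeroSetGe ψ σ T := fun ρ ⟨h0, h1, h2⟩ ↦ ⟨h0, h1.le, h2⟩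
  unfold charZeroCountRe ChenGuptaLi2025.charZeroCountMult
  rw [finsum_mem_eq_finite_toFinset_sum _ (hfin.subset hsub), finsum_mem_eq_finite_toFinset_sum _ hfin]
  exact Finset.sum_le_sum_of_subset (Set.Finite.toFinset_subset_toFinset.2 hsub)

/-- Summed over the primitive characters: `Σ*_ψ N_BH(σ, T, ψ) ≤ Σ_{χ mod q} N_CGL(σ, T, χ)`
(`σ > 0`; primitive characters are among all characters and every term is `≥ 0`).
[cite: BondarenkoHeap2026, Proposition 2 (attribution to Chen–Gupta–Li), p. 9] -/
theorem sum_charZeroCountRe_le_modZeroCountMult (q : ℕ) [NeZero q] {σ : ℝ} (hσ : 0 < σ) (T : ℝ) :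
    (∑ ψ : DirichletCharacter ℂ q with ψ.IsPrimitive, charZeroCountRe ψ σ T) ≤
      modZeroCountMult q σ T := by
  calc (∑ ψ : DirichletCharacter ℂ q with ψ.IsPrimitive, charZeroCountRe ψ σ T)
      ≤ ∑ ψ : DirichletCharacter ℂ q with ψ.IsPrimitive, charZeroCountMult ψ σ T :=
        Finset.sum_le_sum fun ψ hψ ↦
          charZeroCountRe_le_charZeroCountMult (Finset.mem_filter.1 hψ).2 hσ T
    _ ≤ ∑ ψ : DirichletCharacter ℂ q, charZeroCountMult ψ σ T :=
        Finset.sum_le_sum_of_subset (Finset.filter_subset _ _)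
    _ = modZeroCountMult q σ T := rfl

/-- **Pointwise-in-`σ` density for BH's primitive sum from CGL Theorem 1.2**: for every
`σ ∈ (1/2, 1)` and `ε > 0` there is `C > 0` with `Σ*_ψ N(σ, H, ψ) ≤ C (qH)^{7(1−σ)/3+ε}` for all
`q ≥ 1`, `H ≥ 1`. [cite: BondarenkoHeap2026, Proposition 2, eq. (9), p. 9] -/
theorem sum_charZeroCountRe_le_of_allCases_mult (h : theorem12_allCases_mult) {σ : ℝ}
    (hσ : 1 / 2 < σ) (hσ' : σ < 1) {ε : ℝ} (hε : 0 < ε) :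
    ∃ C : ℝ, 0 < C ∧ ∀ (q : ℕ) [NeZero q] (H : ℝ), 1 ≤ H →
      (∑ ψ : DirichletCharacter ℂ q with ψ.IsPrimitive, (charZeroCountRe ψ σ H : ℝ)) ≤
        C * ((q : ℝ) * H) ^ (7 * (1 - σ) / 3 + ε) := by
  obtain ⟨C, hC, hmain⟩ := ChenGuptaLi2025.sevenThirds_mult_of_allCases_mult h σ hσ hσ' ε hε
  refine ⟨C, hC, fun q _ H hH ↦ ?_⟩
  have hnat := sum_charZeroCountRe_le_modZeroCountMult q (by linarith : (0 : ℝ) < σ) H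
  calc (∑ ψ : DirichletCharacter ℂ q with ψ.IsPrimitive, (charZeroCountRe ψ σ H : ℝ))
      = ((∑ ψ : DirichletCharacter ℂ q with ψ.IsPrimitive, charZeroCountRe ψ σ H : ℕ) : ℝ) := by
        push_cast; rfl
    _ ≤ (modZeroCountMult q σ H : ℝ) := by exact_mod_cast hnat
    _ ≤ C * ((q : ℝ) * H) ^ (7 * (1 - σ) / 3 + ε) := hmain q H hH

/-! ### The trivial count at `σ = 1/2` -/

/-- **The trivial count, per character**: there is an absolute `C₁ > 0` such that for every
`q ≥ 1`, every primitive `ψ` mod `q` and every `H ≥ 1`,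
`N(1/2, H, ψ) ≤ C₁ (H + 2)(log q + log(H + 6))` — for `q > 1` by the unit-window bound
`ExplicitPsiChar.exists_sum_window_le` (MV Thm 10.17) over the `≤ 2H + 5` integer windows meeting
`|γ| ≤ H`, for `q = 1` by the `ζ` count `exists_sum_zeroOrder_le_mul_log` (MV Thm 10.13 summed).
[cite: MontgomeryVaughan2007, Theorems 10.13, 10.17] -/
theorem exists_charZeroCountRe_half_le :
    ∃ C₁ : ℝ, 0 < C₁ ∧ ∀ (q : ℕ) [NeZero q] (ψ : DirichletCharacter ℂ q), ψ.IsPrimitive →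
      ∀ H : ℝ, 1 ≤ H →
        (charZeroCountRe ψ (1 / 2) H : ℝ) ≤ C₁ * (H + 2) * (Real.log q + Real.log (H + 6)) := by
  obtain ⟨C, hC, hwin⟩ := ExplicitPsiChar.exists_sum_window_le
  obtain ⟨Cζ, hCζ, hzeta⟩ := exists_sum_zeroOrder_le_mul_log
  refine ⟨3 * C + Cζ, by positivity, fun q _ ψ hψ H hH ↦ ?_⟩
  have hH0 : 0 ≤ H := by linarith
  have hq1 : (1 : ℝ) ≤ q := by exact_mod_cast Nat.one_le_iff_ne_zero.2 (NeZero.ne q)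
  have hlogq : 0 ≤ Real.log q := Real.log_nonneg hq1
  have hlog6 : 0 ≤ Real.log (H + 6) := Real.log_nonneg (by linarith)
  have hfin := zeroSetRe_finite_of_isPrimitive hψ (by norm_num : (0 : ℝ) ≤ 1 / 2) H
  have hsum : (charZeroCountRe ψ (1 / 2) H : ℝ) = ∑ ρ ∈ hfin.toFinset, (zeroOrder ψ ρ : ℝ) := by
    unfold charZeroCountRe
    rw [finsum_mem_eq_finite_toFinset_sum _ hfin]
    push_cast
    rfl
  rw [hsum]
  rcases eq_or_ne q 1 with rfl | hq
  · -- `q = 1`: `L(s, ψ) = ζ(s)`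
    have hmem : ∀ ρ ∈ hfin.toFinset, ρ ∈ zetaZerosRight ∧ |ρ.im| ≤ H := by
      intro ρ hρ
      rw [Set.Finite.mem_toFinset] at hρ
      obtain ⟨h0, h1, h2⟩ := hρ
      rw [DirichletCharacter.LFunction_modOne_eq] at h0
      exact ⟨⟨h0, by linarith⟩, h2⟩
    have hne1 : ∀ ρ ∈ hfin.toFinset, ρ ≠ 1 := by
      intro ρ hρ h1
      have := (hmem ρ hρ).1.1
      rw [h1] at this
      exact riemannZeta_one_ne_zero this
    have heq : ∑ ρ ∈ hfin.toFinset, (zeroOrder ψ ρ : ℝ) =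
        ∑ ρ ∈ hfin.toFinset, (riemannZetaZeroOrder ρ : ℝ) := by
      refine Finset.sum_congr rfl fun ρ hρ ↦ ?_
      rw [← natCast_zeroOrder_level_one ψ (hne1 ρ hρ)]
      norm_cast
    rw [heq]
    have hz := hzeta H hH hfin.toFinset hmem
    have hlog2 : Real.log (H + 2) ≤ Real.log (H + 6) := Real.log_le_log (by linarith) (by linarith)
    have hlog2' : 0 ≤ Real.log (H + 2) := Real.log_nonneg (by linarith)
    calc ∑ ρ ∈ hfin.toFinset, (riemannZetaZeroOrder ρ : ℝ) ≤ Cζ * (H + 2) * Real.log (H + 2) := hz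
      _ ≤ Cζ * (H + 2) * (Real.log ((1 : ℕ) : ℝ) + Real.log (H + 6)) := by
          rw [Nat.cast_one, Real.log_one, zero_add]
          exact mul_le_mul_of_nonneg_left hlog2 (by positivity)
      _ ≤ (3 * C + Cζ) * (H + 2) * (Real.log ((1 : ℕ) : ℝ) + Real.log (H + 6)) := by
          rw [Nat.cast_one, Real.log_one, zero_add]
          have : 0 ≤ 3 * C * (H + 2) * Real.log (H + 6) := by positivity
          nlinarith
  · -- `q > 1`: unit windows
    have hq' : 1 < q := Nat.one_lt_iff_ne_zero_and_ne_one.2 ⟨NeZero.ne q, hq⟩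
    have hne : ψ ≠ 1 := ne_one_of_isPrimitive_of_ne_one hψ hq
    set N₀ : ℕ := ⌈H⌉₊ + 1 with hN₀
    have hN₀H : (N₀ : ℝ) < H + 2 := by
      rw [hN₀]; push_cast; linarith [Nat.ceil_lt_add_one hH0]
    have hHN₀ : H ≤ ⌈H⌉₊ := Nat.le_ceil H
    set t : Finset ℤ := Finset.Icc (-(N₀ : ℤ)) N₀ with ht
    -- every zero of the box falls in the window of the nearest integer, of index `≤ N₀`
    have hmaps : ∀ ρ ∈ hfin.toFinset, round ρ.im ∈ t := by
      intro ρ hρ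
      rw [Set.Finite.mem_toFinset] at hρ
      obtain ⟨-, -, h2⟩ := hρ
      have hr : |ρ.im - round ρ.im| ≤ 1 / 2 := abs_sub_round ρ.im
      have habs : |((round ρ.im : ℤ) : ℝ)| ≤ N₀ := by
        have h3 : |((round ρ.im : ℤ) : ℝ)| ≤ |ρ.im| + 1 / 2 := by
          have := abs_sub_abs_le_abs_sub ((round ρ.im : ℤ) : ℝ) ρ.im
          rw [abs_sub_comm] at this
          linarith
        rw [hN₀]; push_cast; linarith
      have habs' : |round ρ.im| ≤ (N₀ : ℤ) := by
        have : ((|round ρ.im| : ℤ) : ℝ) ≤ ((N₀ : ℤ) : ℝ) := by push_cast; exact habs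
        exact_mod_cast this
      rw [ht, Finset.mem_Icc]
      exact abs_le.1 habs'
    rw [← Finset.sum_fiberwise_of_maps_to hmaps]
    -- each window carries `≤ C (log q + log(H + 6))`
    have hwin' : ∀ k ∈ t, ∑ ρ ∈ hfin.toFinset with round ρ.im = k, (zeroOrder ψ ρ : ℝ) ≤
        C * (Real.log q + Real.log (H + 6)) := by
      intro k hk
      have hkabs : |(k : ℝ)| ≤ H + 2 := by
        rw [ht, Finset.mem_Icc] at hk
        have : |k| ≤ (N₀ : ℤ) := abs_le.2 hk
        have : ((|k| : ℤ) : ℝ) ≤ ((N₀ : ℤ) : ℝ) := by exact_mod_cast this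
        rw [Int.cast_abs, Int.cast_natCast] at this
        linarith
      have hP : ∀ ρ ∈ hfin.toFinset.filter (fun ρ ↦ round ρ.im = k),
          ψ.LFunction ρ = 0 ∧ 0 < ρ.re ∧ ρ.re < 1 ∧ |ρ.im - k| ≤ 1 / 2 := by
        intro ρ hρ
        rw [Finset.mem_filter, Set.Finite.mem_toFinset] at hρ
        obtain ⟨hmem, hk'⟩ := hρ
        obtain ⟨h0, h1, h2, -⟩ := zeroSetRe_subset_lfunctionZeroBox hne
          (by norm_num : (0 : ℝ) ≤ 1 / 2) H hmem
        refine ⟨h0, h1, h2, ?_⟩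
        rw [← hk']
        exact abs_sub_round ρ.im
      calc ∑ ρ ∈ hfin.toFinset with round ρ.im = k, (zeroOrder ψ ρ : ℝ)
          ≤ C * (Real.log q + Real.log (|(k : ℝ)| + 4)) := hwin q ψ hψ hq' k _ hP
        _ ≤ C * (Real.log q + Real.log (H + 6)) := by
            have : Real.log (|(k : ℝ)| + 4) ≤ Real.log (H + 6) :=
              Real.log_le_log (by positivity) (by linarith)
            exact mul_le_mul_of_nonneg_left (by linarith) hC.le
    have hcard : (t.card : ℝ) ≤ 3 * (H + 2) := by
      have : t.card = 2 * N₀ + 1 := by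
        rw [ht, Int.card_Icc]
        have : (N₀ : ℤ) + 1 - -(N₀ : ℤ) = ((2 * N₀ + 1 : ℕ) : ℤ) := by push_cast; ring
        rw [this, Int.toNat_natCast]
      rw [this]; push_cast; linarith
    calc ∑ k ∈ t, ∑ ρ ∈ hfin.toFinset with round ρ.im = k, (zeroOrder ψ ρ : ℝ)
        ≤ ∑ _k ∈ t, C * (Real.log q + Real.log (H + 6)) := Finset.sum_le_sum hwin'
      _ = t.card * (C * (Real.log q + Real.log (H + 6))) := by
          rw [Finset.sum_const, nsmul_eq_mul]
      _ ≤ 3 * (H + 2) * (C * (Real.log q + Real.log (H + 6))) :=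
          mul_le_mul_of_nonneg_right hcard (by positivity)
      _ ≤ (3 * C + Cζ) * (H + 2) * (Real.log q + Real.log (H + 6)) := by
          have : 0 ≤ Cζ * (H + 2) * (Real.log q + Real.log (H + 6)) := by positivity
          nlinarith

/-- There are `φ(q) ≤ q` Dirichlet characters modulo `q`. [folklore] -/
private theorem card_dirichletCharacter_le (q : ℕ) [NeZero q] :
    Fintype.card (DirichletCharacter ℂ q) ≤ q := by
  rw [← Nat.card_eq_fintype_card, DirichletCharacter.card_eq_totient_of_hasEnoughRootsOfUnity ℂ q]
  exact Nat.totient_le q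

/-- **The trivial count, summed and in power form**: for every `ε > 0` there is `K > 0` with
`Σ*_{ψ mod q primitive} N(1/2, H, ψ) ≤ K (qH)^{1+ε}` for all `q ≥ 1`, `H ≥ 1`
(`≤ q` characters, each `≪ H log(7qH)`, and `log x ≤ x^ε/ε`).
[cite: MontgomeryVaughan2007, Theorems 10.13, 10.17] -/
theorem exists_sum_charZeroCountRe_half_le_rpow {ε : ℝ} (hε : 0 < ε) :
    ∃ K : ℝ, 0 < K ∧ ∀ (q : ℕ) [NeZero q] (H : ℝ), 1 ≤ H →
      (∑ ψ : DirichletCharacter ℂ q with ψ.IsPrimitive, (charZeroCountRe ψ (1 / 2) H : ℝ)) ≤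
        K * ((q : ℝ) * H) ^ (1 + ε) := by
  obtain ⟨C₁, hC₁, hper⟩ := exists_charZeroCountRe_half_le
  refine ⟨3 * C₁ * (7 : ℝ) ^ ε / ε, by positivity, fun q _ H hH ↦ ?_⟩
  have hH0 : 0 < H := by linarith
  have hq1 : (1 : ℝ) ≤ q := by exact_mod_cast Nat.one_le_iff_ne_zero.2 (NeZero.ne q)
  have hq0 : (0 : ℝ) < q := by linarith
  have hqH : 0 < (q : ℝ) * H := by positivity
  -- per character: `C₁ (H+2)(log q + log(H+6)) ≤ 3 C₁ H (7qH)^ε / ε`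
  have hlog : Real.log q + Real.log (H + 6) ≤ (7 : ℝ) ^ ε * ((q : ℝ) * H) ^ ε / ε := by
    have h1 : Real.log q + Real.log (H + 6) = Real.log ((q : ℝ) * (H + 6)) :=
      (Real.log_mul hq0.ne' (by linarith)).symm
    have h2 : Real.log ((q : ℝ) * (H + 6)) ≤ Real.log (7 * ((q : ℝ) * H)) :=
      Real.log_le_log (by positivity) (by nlinarith)
    have h3 : Real.log (7 * ((q : ℝ) * H)) ≤ (7 * ((q : ℝ) * H)) ^ ε / ε :=
      Real.log_le_rpow_div (by positivity) hε
    rw [Real.mul_rpow (by norm_num) hqH.le] at h3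
    linarith
  have hone : ∀ ψ ∈ (Finset.univ.filter fun ψ : DirichletCharacter ℂ q ↦ ψ.IsPrimitive),
      (charZeroCountRe ψ (1 / 2) H : ℝ) ≤ 3 * C₁ * H * ((7 : ℝ) ^ ε * ((q : ℝ) * H) ^ ε / ε) := by
    intro ψ hψ
    have hp := hper q ψ (Finset.mem_filter.1 hψ).2 H hH
    have hpos : 0 ≤ Real.log q + Real.log (H + 6) :=
      add_nonneg (Real.log_nonneg hq1) (Real.log_nonneg (by linarith))
    calc (charZeroCountRe ψ (1 / 2) H : ℝ) ≤ C₁ * (H + 2) * (Real.log q + Real.log (H + 6)) := hp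
      _ ≤ C₁ * (3 * H) * (Real.log q + Real.log (H + 6)) := by
          apply mul_le_mul_of_nonneg_right _ hpos
          exact mul_le_mul_of_nonneg_left (by linarith) hC₁.le
      _ ≤ C₁ * (3 * H) * ((7 : ℝ) ^ ε * ((q : ℝ) * H) ^ ε / ε) :=
          mul_le_mul_of_nonneg_left hlog (by positivity)
      _ = 3 * C₁ * H * ((7 : ℝ) ^ ε * ((q : ℝ) * H) ^ ε / ε) := by ring
  have hcard : ((Finset.univ.filter fun ψ : DirichletCharacter ℂ q ↦ ψ.IsPrimitive).card : ℝ) ≤ q := by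
    have h1 := Finset.card_filter_le (Finset.univ : Finset (DirichletCharacter ℂ q))
      (fun ψ : DirichletCharacter ℂ q ↦ ψ.IsPrimitive)
    rw [Finset.card_univ] at h1
    exact_mod_cast h1.trans (card_dirichletCharacter_le q)
  calc (∑ ψ : DirichletCharacter ℂ q with ψ.IsPrimitive, (charZeroCountRe ψ (1 / 2) H : ℝ))
      ≤ (Finset.univ.filter fun ψ : DirichletCharacter ℂ q ↦ ψ.IsPrimitive).card •
          (3 * C₁ * H * ((7 : ℝ) ^ ε * ((q : ℝ) * H) ^ ε / ε)) := Finset.sum_le_card_nsmul _ _ _ hone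
    _ ≤ (q : ℝ) * (3 * C₁ * H * ((7 : ℝ) ^ ε * ((q : ℝ) * H) ^ ε / ε)) := by
        rw [nsmul_eq_mul]
        exact mul_le_mul_of_nonneg_right hcard (by positivity)
    _ = 3 * C₁ * (7 : ℝ) ^ ε / ε * ((q : ℝ) * H) ^ (1 + ε) := by
        rw [Real.rpow_add hqH, Real.rpow_one]
        field_simp

/-! ### Assembly: Proposition 2 from Theorem 1.2 -/

/-- **Bondarenko–Heap 2026, Proposition 2, FROM Chen–Gupta–Li 2025, Theorem 1.2** («In all
cases» display, zeros with multiplicity): `ChenGuptaLi2025.theorem12_allCases_mult → prop2`.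
Given `ε > 0`, put `δ = min(1/14, 3ε/14)` and cover `[1/2, 1)` by the strips
`[1/2 + jδ, 1/2 + (j+1)δ)`: on the strip `j = 0` (inside `σ ≤ 4/7`, where `7(1−σ)/3 ≥ 1`) use the
trivial count `Σ* N(1/2, H, ψ) ≤ K (qH)^{1+ε}` and antitonicity in `σ`; on the strip `j ≥ 1` use
the pointwise bound at `σ_j = 1/2 + jδ ∈ (1/2, 1)` with `ε/2` (the loss `7(σ − σ_j)/3 < 7δ/3 ≤ ε/2`
is absorbed), again by antitonicity; only the finitely many `j ≤ ⌈1/(2δ)⌉` occur, so the sum of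
their constants plus `K` serves as the uniform constant. PROVED; hypothesis-free apart from the
named fact. [cite: BondarenkoHeap2026, Proposition 2, eq. (9), §3 p. 9 ("This is due to
Chen–Gupta–Li")] -/
theorem prop2_of_theorem12_allCases_mult (h : theorem12_allCases_mult) : prop2 := by
  intro ε hε
  -- the grid step
  set δ : ℝ := min (1 / 14) (3 * ε / 14) with hδ
  have hδ0 : 0 < δ := lt_min (by norm_num) (by positivity)
  have hδ1 : δ ≤ 1 / 14 := min_le_left _ _
  have hδ2 : δ ≤ 3 * ε / 14 := min_le_right _ _
  -- the trivial strip
  obtain ⟨K, hK, hK'⟩ := exists_sum_charZeroCountRe_half_le_rpow hε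
  -- the grid constants
  have hgrid : ∀ j : ℕ, ∃ Cj : ℝ, 0 ≤ Cj ∧ ((1 / 2 : ℝ) < 1 / 2 + j * δ → 1 / 2 + j * δ < 1 →
      ∀ (q : ℕ) [NeZero q] (H : ℝ), 1 ≤ H →
        (∑ ψ : DirichletCharacter ℂ q with ψ.IsPrimitive,
            (charZeroCountRe ψ (1 / 2 + j * δ) H : ℝ)) ≤
          Cj * ((q : ℝ) * H) ^ (7 * (1 - (1 / 2 + j * δ)) / 3 + ε / 2)) := by
    intro j
    by_cases hj : (1 / 2 : ℝ) < 1 / 2 + j * δ ∧ 1 / 2 + j * δ < 1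
    · obtain ⟨C, hC, hC'⟩ := sum_charZeroCountRe_le_of_allCases_mult h hj.1 hj.2 (half_pos hε)
      exact ⟨C, hC.le, fun _ _ ↦ hC'⟩
    · exact ⟨0, le_rfl, fun h1 h2 ↦ (hj ⟨h1, h2⟩).elim⟩
  choose Cf hCf0 hCf using hgrid
  set J : ℕ := ⌈1 / (2 * δ)⌉₊ with hJ
  set Cgrid : ℝ := ∑ j ∈ Finset.range (J + 1), Cf j with hCgrid
  have hCgrid0 : 0 ≤ Cgrid := Finset.sum_nonneg fun j _ ↦ hCf0 j
  refine ⟨K + Cgrid + 1, by positivity, fun q _ σ H hσ hσ1 hH ↦ ?_⟩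
  have hq1 : (1 : ℝ) ≤ q := by exact_mod_cast Nat.one_le_iff_ne_zero.2 (NeZero.ne q)
  have hqH : 1 ≤ (q : ℝ) * H := one_le_mul_of_one_le_of_one_le hq1 hH
  have hrpow0 : 0 ≤ ((q : ℝ) * H) ^ (7 * (1 - σ) / 3 + ε) := Real.rpow_nonneg (by linarith) _
  -- antitonicity of the primitive sum in `σ`
  have hanti : ∀ σ₁ σ₂ : ℝ, 0 ≤ σ₁ → σ₁ ≤ σ₂ →
      (∑ ψ : DirichletCharacter ℂ q with ψ.IsPrimitive, (charZeroCountRe ψ σ₂ H : ℝ)) ≤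
        ∑ ψ : DirichletCharacter ℂ q with ψ.IsPrimitive, (charZeroCountRe ψ σ₁ H : ℝ) :=
    fun σ₁ σ₂ h1 h2 ↦ Finset.sum_le_sum fun ψ hψ ↦ by
      exact_mod_cast charZeroCountRe_anti (Finset.mem_filter.1 hψ).2 h1 h2 H
  by_cases hcase : σ < 1 / 2 + δ
  · -- the trivial strip `σ ∈ [1/2, 1/2 + δ) ⊆ [1/2, 4/7)`
    have hexp : 1 + ε ≤ 7 * (1 - σ) / 3 + ε := by linarith
    calc (∑ ψ : DirichletCharacter ℂ q with ψ.IsPrimitive, (charZeroCountRe ψ σ H : ℝ))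
        ≤ ∑ ψ : DirichletCharacter ℂ q with ψ.IsPrimitive, (charZeroCountRe ψ (1 / 2) H : ℝ) :=
          hanti (1 / 2) σ (by norm_num) hσ
      _ ≤ K * ((q : ℝ) * H) ^ (1 + ε) := hK' q H hH
      _ ≤ K * ((q : ℝ) * H) ^ (7 * (1 - σ) / 3 + ε) :=
          mul_le_mul_of_nonneg_left (Real.rpow_le_rpow_of_exponent_le hqH hexp) hK.le
      _ ≤ (K + Cgrid + 1) * ((q : ℝ) * H) ^ (7 * (1 - σ) / 3 + ε) :=
          mul_le_mul_of_nonneg_right (by linarith) hrpow0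
  · -- the grid strips: `σ_j = 1/2 + jδ ≤ σ < σ_j + δ` with `j = ⌊(σ − 1/2)/δ⌋ ≥ 1`
    push Not at hcase
    set j : ℕ := ⌊(σ - 1 / 2) / δ⌋₊ with hjdef
    have hx0 : 0 ≤ (σ - 1 / 2) / δ := div_nonneg (by linarith) hδ0.le
    have hjle : (j : ℝ) * δ ≤ σ - 1 / 2 := by
      have := Nat.floor_le hx0
      rw [← hjdef] at this
      rwa [le_div_iff₀ hδ0] at this
    have hjlt : σ - 1 / 2 < j * δ + δ := by
      have := Nat.lt_floor_add_one ((σ - 1 / 2) / δ)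
      rw [← hjdef, div_lt_iff₀ hδ0] at this
      linarith
    have hj1 : (1 : ℝ) ≤ j := by
      have h1 : 1 ≤ (σ - 1 / 2) / δ := by rw [le_div_iff₀ hδ0]; linarith
      have : 1 ≤ j := by rw [hjdef]; exact Nat.le_floor (by exact_mod_cast h1)
      exact_mod_cast this
    have hσj : (1 / 2 : ℝ) < 1 / 2 + j * δ := by nlinarith
    have hσj' : 1 / 2 + (j : ℝ) * δ < 1 := by linarith
    have hjJ : j ≤ J := by
      have h1 : (j : ℝ) ≤ 1 / (2 * δ) := by
        have h2 : (j : ℝ) ≤ (σ - 1 / 2) / δ := by rw [hjdef]; exact Nat.floor_le hx0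
        have h3 : (σ - 1 / 2) / δ ≤ 1 / (2 * δ) := by
          rw [div_le_div_iff₀ hδ0 (by positivity)]
          nlinarith
        linarith
      have h4 : (j : ℝ) ≤ J := h1.trans (by rw [hJ]; exact Nat.le_ceil _)
      exact_mod_cast h4
    have hCj : Cf j ≤ Cgrid := by
      rw [hCgrid]
      exact Finset.single_le_sum (fun i _ ↦ hCf0 i) (Finset.mem_range.2 (Nat.lt_succ_of_le hjJ))
    have hmain := hCf j hσj hσj' q H hH
    have hexp : 7 * (1 - (1 / 2 + (j : ℝ) * δ)) / 3 + ε / 2 ≤ 7 * (1 - σ) / 3 + ε := by linarith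
    calc (∑ ψ : DirichletCharacter ℂ q with ψ.IsPrimitive, (charZeroCountRe ψ σ H : ℝ))
        ≤ ∑ ψ : DirichletCharacter ℂ q with ψ.IsPrimitive,
            (charZeroCountRe ψ (1 / 2 + j * δ) H : ℝ) :=
          hanti (1 / 2 + j * δ) σ (by linarith) (by linarith)
      _ ≤ Cf j * ((q : ℝ) * H) ^ (7 * (1 - (1 / 2 + (j : ℝ) * δ)) / 3 + ε / 2) := hmain
      _ ≤ Cf j * ((q : ℝ) * H) ^ (7 * (1 - σ) / 3 + ε) :=
          mul_le_mul_of_nonneg_left (Real.rpow_le_rpow_of_exponent_le hqH hexp) (hCf0 j)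
      _ ≤ (K + Cgrid + 1) * ((q : ℝ) * H) ^ (7 * (1 - σ) / 3 + ε) :=
          mul_le_mul_of_nonneg_right (by linarith) hrpow0


/-! ### The apex in the tree: every BH26 fact downstream of Proposition 2, from the CGL theorem -/

/-- **(40), Range III (primed interface) from Chen–Gupta–Li** (`∘ rangeIII'_bound_of_prop2`).
[claim: BondarenkoHeap2026, status: under-review] -/
theorem rangeIII'_bound_of_theorem12_allCases_mult (h : theorem12_allCases_mult) : rangeIII'_bound :=
  rangeIII'_bound_of_prop2 (prop2_of_theorem12_allCases_mult h)

/-- **Lemma 10 from Chen–Gupta–Li** (`∘ lemma10_of_prop2`). [claim: BondarenkoHeap2026, status: under-review] -/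
theorem lemma10_of_theorem12_allCases_mult (h : theorem12_allCases_mult) : lemma10 :=
  lemma10_of_prop2 (prop2_of_theorem12_allCases_mult h)

/-- **Lemma 10 (primed form) from Chen–Gupta–Li** (`∘ lemma10'_of_prop2`).
[claim: BondarenkoHeap2026, status: under-review] -/
theorem lemma10'_of_theorem12_allCases_mult (h : theorem12_allCases_mult) : lemma10' :=
  lemma10'_of_prop2 (prop2_of_theorem12_allCases_mult h)

/-- **Proposition 6 from Chen–Gupta–Li** (`∘ prop6_of_reduction'_of_ranges'` with the landed
`offDiag_reduction'_holds`, `rangeI'_bound_holds`, `rangeII'_bound_holds`).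
[claim: BondarenkoHeap2026, status: under-review] -/
theorem prop6_of_theorem12_allCases_mult (h : theorem12_allCases_mult) : prop6 :=
  prop6_of_reduction'_of_ranges' offDiag_reduction'_holds rangeI'_bound_holds rangeII'_bound_holds
    (rangeIII'_bound_of_theorem12_allCases_mult h)

/-- **Theorem 4 from Chen–Gupta–Li** (`∘ theorem4_of_prop3_prop6 prop3_holds`).
[claim: BondarenkoHeap2026, status: under-review] -/
theorem theorem4_of_theorem12_allCases_mult (h : theorem12_allCases_mult) : theorem4 :=
  theorem4_of_prop3_prop6 prop3_holds (prop6_of_theorem12_allCases_mult h)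

/-- **Equation (8) from Chen–Gupta–Li** (`∘ equation8_glue_holds` with `proposition1_holds`,
`theorem3_holds`, Theorem 4 above, `cPhi_pos_holds`, `weightHat_zero_holds`, `extensionToLine_holds`;
RH stays the antecedent INSIDE `equation8`). [claim: BondarenkoHeap2026, status: under-review] -/
theorem equation8_of_theorem12_allCases_mult (h : theorem12_allCases_mult) : equation8 :=
  equation8_glue_holds proposition1_holds theorem3_holds (theorem4_of_theorem12_allCases_mult h)
    cPhi_pos_holds weightHat_zero_holds extensionToLine_holds

end Literature.NumberTheory.LFunctions.BondarenkoHeap2026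

namespace Literature.NumberTheory.LFunctions

open BondarenkoHeap2026

/-- **Bondarenko–Heap 2026, Theorem 1, from Chen–Gupta–Li 2025, Theorem 1.2** — the kernel census
v22 IN THE TREE: `bondarenkoHeap2026_theorem1` (`∃ E₀ ≥ 10, SiegelZerosOfQuality E₀ →
RiemannHypothesis → ZetaGapLiminfBelow 0.4733`) from the single external named fact
`ChenGuptaLi2025.theorem12_allCases_mult`, the term being the lead's `apex_of_leaves_v22` verbatim
(`bondarenkoHeap2026_theorem1_of_internal proposition1_holds theorem3_holds (theorem4 …)
cPhi_pos_holds weightHat_zero_holds extensionToLine_holds numericalInequality8_holds`). The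
statement proved is the printed CONDITIONAL; nothing here asserts RH, Siegel zeros or small gaps.
NOT RH-BEARING. [claim: BondarenkoHeap2026, status: under-review] -/
theorem bondarenkoHeap2026_theorem1_of_theorem12_allCases_mult
    (h : ChenGuptaLi2025.theorem12_allCases_mult) : bondarenkoHeap2026_theorem1 :=
  bondarenkoHeap2026_theorem1_of_internal proposition1_holds theorem3_holds
    (theorem4_of_prop3_prop6 prop3_holds
      (prop6_of_reduction'_of_ranges' offDiag_reduction'_holds rangeI'_bound_holds rangeII'_bound_holds
        (rangeIII'_bound_of_prop2 (prop2_of_theorem12_allCases_mult h))))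
    cPhi_pos_holds weightHat_zero_holds extensionToLine_holds numericalInequality8_holds

/-- **Bondarenko–Heap 2026, Corollary 2, from Chen–Gupta–Li 2025, Theorem 1.2**
(`∘ bondarenkoHeap2026_corollary2_of_theorem1`). NOT RH-BEARING.
[claim: BondarenkoHeap2026, status: under-review] -/
theorem bondarenkoHeap2026_corollary2_of_theorem12_allCases_mult
    (h : ChenGuptaLi2025.theorem12_allCases_mult) : bondarenkoHeap2026_corollary2 :=
  bondarenkoHeap2026_corollary2_of_theorem1 (bondarenkoHeap2026_theorem1_of_theorem12_allCases_mult h)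

end Literature.NumberTheory.LFunctions
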